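import Summits.AtomisticToContinuum.Crystallization.Theorems.FrustratedLawDichotomyStrainedPatchCoverBridge

/-!
(PRE-SPLIT FOR THE 400-LINE CAP, lens-5 g84: this file = part 1 of 2 (§0 pair tables, §1 GB-charts, §2 the two leaves); sequel `…FrustratedLawDichotomyStrainedPatchPairTube`
imports it; same namespace, all FQNs as in the farm-checked chain HOME/decomp-a2c-lens-5/g84/lean/FrustratedLawDichotomyStrainedPatchPairTube.lean.)
# Strained patch · «PairTube» A: the BOND-DIFFERENCE tube — pair tables, GB-charts `‖D a − D b‖ ≤ B(z₀)(e a, e b)`, the leaves (TF-GB) / (BC-GB) and their order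

Lineage `…Theses.FrustratedLawDichotomy.AperiodicFrustratedLawGap` (stmt-27623); T-leaf target of record **[CORE-FAR]** `CoreOffTubeFloor (63/10) (63/10) (24/5) (1/100) 0`
⟸ (TF-G) `TubeFloorG 𝓘 τ T` ∧ (BC-G) `FamilyCoverG 𝓘 ρ ε (1/8) τ T` (77G `…GradedTube`).  WHY A NEW CURRENCY: every SITE-table cell at `ϱ = 133/10` is dead
for cause (census FINAL, critic rows 1359/1361/1367: `[T_min, E_cap]` EMPTY on FZ09/FZ62/HM62).  A site table prices a ball sites WHOLE displacement
`D a := (z a − z c) − (z₀ (e a) − z₀ c₀)`, so the certificates adversary may move two NEIGHBOURS independently in their boxes (pair deviation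
`T(e a) + T(e b) ≈ 2τ`, `chartByG_bond`) — a local strain no cluster charted at amplitude `τ` exhibits; but the score `ballAvg (9/5) z (xRec M z) c` is a
PAIR functional (finite-range `effPot`, `Collar (9/2)` flags; `63/10 = 9/5 + 9/2`): it sees only the differences `D a − D b`, `|ab| ≤ 9/2`, `a` in the core.
This file types the currency that budgets the DIFFERENCES: `ChartByGB 𝓘 τ T B` (§1), pair tables `pairSum` / `conePair` / `innerCone` / `pairTolOf` (§0),
the leaves (TF-GB) `TubeFloorGB` [CERTIFICATE · UNDECIDED · INSTRUMENTABLE «PAIR-84-E»] and (BC-GB) `FamilyCoverGB` [GEOMETRIC · UNDECIDED · INSTRUMENTABLE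
«PAIR-84-T»] (§2) with the PROVED order: (TF-G) ⟹ (TF-GB) ⟹ (TF-G at every sum-dominated `T′`), (BC-GB) ⟹ (BC-G), RECOVERY at `B = pairSum T`
(`tubeFloorGB_pairSum_iff`, `familyCoverGB_pairSum_iff`), pair ⟹ site through the centre (`ChartByGB.dev_centre`, `.siteOfPair`), chains (`.dev_via`).
The junction to [CORE-FAR] and to the crux BY NAME, the cover cut (D_GB) `RefineGB` and the cell shapes are in the sequel.  Sorry-free over tree definitions.
-/

noncomputable section

namespace Summit.AtomisticToContinuum.Crystallization.Theorems.FrustratedLawDichotomyStrainedPatchPairTube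

open scoped BigOperators Classical
open Summit.AtomisticToContinuum.Crystallization.Theorems.ChargedEnergyGapNegative (eStar E3)
open Summit.AtomisticToContinuum.Crystallization.Theorems.FrustratedLawDichotomyRangeCut
open Summit.AtomisticToContinuum.Crystallization.Theorems.FrustratedLawDichotomySchurCut
open Summit.AtomisticToContinuum.Crystallization.Theorems.FrustratedLawDichotomyMotifLemmas (GoodAtScale)
open Summit.AtomisticToContinuum.Crystallization.Theorems.FrustratedLawDichotomyAveragingCut (ballAvg)
open Summit.AtomisticToContinuum.Crystallization.Theorems.FrustratedLawDichotomyExemptLocOpt (LocOptFails)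
open Summit.AtomisticToContinuum.Crystallization.Theorems.FrustratedLawDichotomyExemptSplit (SchurElasticPricingX)
open Summit.AtomisticToContinuum.Crystallization.Theorems.FrustratedLawDichotomyExemptAbsorptionRecord
open Summit.AtomisticToContinuum.Crystallization.Theorems.FrustratedLawDichotomyCollarCensus
open Summit.AtomisticToContinuum.Crystallization.Theorems.FrustratedLawDichotomyCollarCensusKappa
open Summit.AtomisticToContinuum.Crystallization.Theorems.FrustratedLawDichotomyStrainedPatchHomSplit
open Summit.AtomisticToContinuum.Crystallization.Theorems.FrustratedLawDichotomyStrainedPatchCleanCollar (CleanBall TailPenalty AnnularDefectFloor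
  DefectiveCollarFloor)
open Summit.AtomisticToContinuum.Crystallization.Theorems.FrustratedLawDichotomyStrainedPatchPhaseCut (MonoPhaseBall AnnularPhaseFloor PolyTextureFloor
  monoPhaseBall_comp_iff)
open Summit.AtomisticToContinuum.Crystallization.Theorems.FrustratedLawDichotomyStrainedPatchCoreTube (NearHomIsoAt CoreOffTubeFloor nearHomIsoAt_comp_iff)
open Summit.AtomisticToContinuum.Crystallization.Theorems.FrustratedLawDichotomyStrainedPatchCoreTubeRecord (CoreCoreRelief)
open Summit.AtomisticToContinuum.Crystallization.Theorems.FrustratedLawDichotomyStrainedPatchStrainBands (EdgeFarFloor coreOff_iff_edge_and_soft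
  softFarFloor_eighth)
open Summit.AtomisticToContinuum.Crystallization.Theorems.FrustratedLawDichotomyStrainedPatchHomIsometry (admissible_comp_iff goodAtScale_comp_iff
  dist_comp injective_comp_iff)
open Summit.AtomisticToContinuum.Crystallization.Theorems.FrustratedLawDichotomyStrainedPatchHomTubeIso (cleanBall_comp_iff ballAvg_xRec_comp)
open Summit.AtomisticToContinuum.Crystallization.Theorems.FrustratedLawDichotomyStrainedPatchChartFamilies (ChartBy FamilyLE familyLE_refl
  ChartBy.mono_t ChartBy.mono_family)
open Summit.AtomisticToContinuum.Crystallization.Theorems.FrustratedLawDichotomyStrainedPatchHostCells (TubeFloor FamilyCover FamP)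
open Summit.AtomisticToContinuum.Crystallization.Theorems.FrustratedLawDichotomyStrainedPatchQuantSlaving (ChartFam SlackTab)
open Summit.AtomisticToContinuum.Crystallization.Theorems.FrustratedLawDichotomyStrainedPatchGradedTube
open Summit.AtomisticToContinuum.Crystallization.Theorems.FrustratedLawDichotomyStrainedPatchCoverBridge

/-! ## §0. Pair tables -/

/-- The type of PAIR (bond-difference) slack tables: host `(M₀, z₀, c₀)` ↦ (host site, host site) ↦ budget. -/
abbrev PairTab : Type := (M₀ : ℕ) → (Fin M₀ → E3) → Fin M₀ → Fin M₀ → Fin M₀ → ℝ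

/-- `pairSum T` — the pair table a SITE table already implies by the triangle inequality: `T(a) + T(b)` (`chartByG_bond`). -/
def pairSum (T : SlackTab) : PairTab := fun M₀ z₀ c₀ a b => T M₀ z₀ c₀ a + T M₀ z₀ c₀ b

/-- The constant pair table. -/
def constPair (β : ℝ) : PairTab := fun _ _ _ _ _ => β

/-- ★ `conePair β s` — the STRAIN CONE: floor `β` plus slope `s` times the HOST pair length (an affine budget: a displacement field of Lipschitz
constant `s` about the host obeys it with `β = 0`). -/
def conePair (β s : ℝ) : PairTab := fun _ z₀ _ a b => β + s * dist (z₀ a) (z₀ b)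

/-- `pairTolOf f` — the general radial pair table: any function of the two host radii and the host pair length. -/
def pairTolOf (f : ℝ → ℝ → ℝ → ℝ) : PairTab := fun _ z₀ c₀ a b => f (dist (z₀ a) (z₀ c₀)) (dist (z₀ b) (z₀ c₀)) (dist (z₀ a) (z₀ b))

/-- ★ `innerCone Rᴱ β s B∞` — the cone `β + s·|ab|` on pairs TOUCHING the inner range (`min` host radius `≤ Rᴱ`; with `Rᴱ ≥ 9/5` these are all the
pairs the score sees), the loose constant `B∞` (e.g. `2τ₀`) on the others. -/
def innerCone (RE β s Binf : ℝ) : PairTab := fun _ z₀ c₀ a b =>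
  if min (dist (z₀ a) (z₀ c₀)) (dist (z₀ b) (z₀ c₀)) ≤ RE then β + s * dist (z₀ a) (z₀ b) else Binf

/-- (piece) [route statement · this cell; NOT a literature fact] `PairLE B B'` — `B` is pointwise at most `B'`. -/
def PairLE (B B' : PairTab) : Prop :=
  ∀ (M₀ : ℕ) (z₀ : Fin M₀ → E3) (c₀ a b : Fin M₀), B M₀ z₀ c₀ a b ≤ B' M₀ z₀ c₀ a b

/-- (piece) [route statement · this cell; NOT a literature fact] `SumLE T B` — the pair table is nowhere below the site sums: then the pair clause carries no information beyond the site clause. -/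
def SumLE (T : SlackTab) (B : PairTab) : Prop := PairLE (pairSum T) B

section Tables

/-- [formal bookkeeping] -/
theorem PairLE.refl (B : PairTab) : PairLE B B := fun _ _ _ _ _ => le_rfl

/-- [formal bookkeeping] -/
theorem PairLE.trans {B B' B'' : PairTab} (h : PairLE B B') (h' : PairLE B' B'') : PairLE B B'' :=
  fun M₀ z₀ c₀ a b => (h M₀ z₀ c₀ a b).trans (h' M₀ z₀ c₀ a b)

/-- `pairSum` is monotone. [formal bookkeeping] -/
theorem pairSum_mono {T T' : SlackTab} (h : TolLE T T') : PairLE (pairSum T) (pairSum T') :=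
  fun M₀ z₀ c₀ a b => add_le_add (h M₀ z₀ c₀ a) (h M₀ z₀ c₀ b)

/-- `pairSum (constTol τ) = constPair (2τ)`. [formal bookkeeping] -/
theorem pairSum_constTol (τ : ℝ) : pairSum (constTol τ) = constPair (2 * τ) := by
  funext M₀ z₀ c₀ a b
  simp only [pairSum, constTol, constPair]
  ring

/-- The cone is monotone in floor and slope (slope on nonnegative lengths). [formal bookkeeping] -/
theorem pairLE_conePair_mono {β β' s s' : ℝ} (hβ : β ≤ β') (hs : s ≤ s') : PairLE (conePair β s) (conePair β' s') := by
  intro M₀ z₀ c₀ a b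
  simp only [conePair]
  have hd : 0 ≤ dist (z₀ a) (z₀ b) := dist_nonneg
  nlinarith [mul_le_mul_of_nonneg_right hs hd]

/-- A cone with nonnegative slope is at least its floor. [formal bookkeeping] -/
theorem pairLE_constPair_conePair {β s : ℝ} (hs : 0 ≤ s) : PairLE (constPair β) (conePair β s) := by
  intro M₀ z₀ c₀ a b
  simp only [conePair, constPair]
  nlinarith [mul_nonneg hs (dist_nonneg : 0 ≤ dist (z₀ a) (z₀ b))]

/-- `SumLE` from a uniform bound: if every site value is at most `β/2`… [formal bookkeeping] -/
theorem sumLE_constPair_of_le {T : SlackTab} {β : ℝ} (h : TolLE T (constTol (β / 2))) : SumLE T (constPair β) := by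
  intro M₀ z₀ c₀ a b
  have ha := h M₀ z₀ c₀ a
  have hb := h M₀ z₀ c₀ b
  simp only [pairSum, constPair, constTol] at ha hb ⊢
  linarith

end Tables

/-! ## §1. GB-charts: graded charts with a pair clause -/

/-- (piece) [route statement · this cell; NOT a literature fact] ★★ **`ChartByGB 𝓘 τ T B z c z₀ c₀ e`** — a graded chart `ChartByG 𝓘 τ T` (scalar `τ`: coarse = fine clause, covering radius `63/10 − τ`, injective
on the ball; site table `T`: `‖D a‖ ≤ T(z₀)(e a)`) whose `63/10`-ball PAIRS additionally satisfy the BOND-DIFFERENCE clause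
`dist (z a − z b) (z₀ (e a) − z₀ (e b)) ≤ B(z₀)(e a, e b)`, i.e. `‖D a − D b‖ ≤ B(e a, e b)`. -/
def ChartByGB (𝓘 : ChartFam) (τ : ℝ) (T : SlackTab) (B : PairTab) {M : ℕ} (z : Fin M → E3) (c : Fin M) {M₀ : ℕ} (z₀ : Fin M₀ → E3)
    (c₀ : Fin M₀) (e : Fin M → Fin M₀) : Prop :=
  ChartByG 𝓘 τ T z c z₀ c₀ e ∧
    ∀ a b, dist (z a) (z c) ≤ 63 / 10 → dist (z b) (z c) ≤ 63 / 10 → dist (z a - z b) (z₀ (e a) - z₀ (e b)) ≤ B M₀ z₀ c₀ (e a) (e b)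

section Chart

variable {𝓘 𝓘' : ChartFam} {τ τ' : ℝ} {T T' : SlackTab} {B B' : PairTab} {M : ℕ} {z : Fin M → E3} {c : Fin M} {M₀ : ℕ} {z₀ : Fin M₀ → E3}
  {c₀ : Fin M₀} {e : Fin M → Fin M₀}

/-- [formal bookkeeping] -/
theorem ChartByGB.chartByG (h : ChartByGB 𝓘 τ T B z c z₀ c₀ e) : ChartByG 𝓘 τ T z c z₀ c₀ e := h.1

/-- [formal bookkeeping] -/
theorem ChartByGB.chartBy (h : ChartByGB 𝓘 τ T B z c z₀ c₀ e) : ChartBy 𝓘 τ τ z c z₀ c₀ e := h.1.1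

/-- The pair clause. [formal bookkeeping] -/
theorem ChartByGB.pair (h : ChartByGB 𝓘 τ T B z c z₀ c₀ e) {a b : Fin M} (ha : dist (z a) (z c) ≤ 63 / 10) (hb : dist (z b) (z c) ≤ 63 / 10) :
    dist (z a - z b) (z₀ (e a) - z₀ (e b)) ≤ B M₀ z₀ c₀ (e a) (e b) := h.2 a b ha hb

/-- The displacement-difference identity: `(z a − z b) − (z₀ (e a) − z₀ (e b)) = D a − D b`. [formal bookkeeping] -/
theorem disp_diff_eq (z : Fin M → E3) (c : Fin M) (z₀ : Fin M₀ → E3) (c₀ : Fin M₀) (e : Fin M → Fin M₀) (a b : Fin M) :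
    (z a - z b) - (z₀ (e a) - z₀ (e b)) = ((z a - z c) - (z₀ (e a) - z₀ c₀)) - ((z b - z c) - (z₀ (e b) - z₀ c₀)) := by abel

/-- The pair clause in displacement form `‖D a − D b‖ ≤ B(e a, e b)`. [formal bookkeeping] -/
theorem ChartByGB.norm_disp_diff (h : ChartByGB 𝓘 τ T B z c z₀ c₀ e) {a b : Fin M} (ha : dist (z a) (z c) ≤ 63 / 10) (hb : dist (z b) (z c) ≤ 63 / 10) :
    ‖((z a - z c) - (z₀ (e a) - z₀ c₀)) - ((z b - z c) - (z₀ (e b) - z₀ c₀))‖ ≤ B M₀ z₀ c₀ (e a) (e b) := by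
  rw [← disp_diff_eq, ← dist_eq_norm]
  exact h.2 a b ha hb

/-- The pair clause in bond-length form `|dist (z a) (z b) − dist (z₀ (e a)) (z₀ (e b))| ≤ B(e a, e b)`. [folklore] -/
theorem ChartByGB.bond (h : ChartByGB 𝓘 τ T B z c z₀ c₀ e) {a b : Fin M} (ha : dist (z a) (z c) ≤ 63 / 10) (hb : dist (z b) (z c) ≤ 63 / 10) :
    |dist (z a) (z b) - dist (z₀ (e a)) (z₀ (e b))| ≤ B M₀ z₀ c₀ (e a) (e b) := by
  have h₁ := h.2 a b ha hb
  rw [dist_eq_norm] at h₁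
  rw [dist_eq_norm, dist_eq_norm]
  exact (abs_norm_sub_norm_le _ _).trans h₁

/-- … and it is never worse than the site sum. [folklore] -/
theorem ChartByGB.bond_min (h : ChartByGB 𝓘 τ T B z c z₀ c₀ e) {a b : Fin M} (ha : dist (z a) (z c) ≤ 63 / 10) (hb : dist (z b) (z c) ≤ 63 / 10) :
    |dist (z a) (z b) - dist (z₀ (e a)) (z₀ (e b))| ≤ min (B M₀ z₀ c₀ (e a) (e b)) (T M₀ z₀ c₀ (e a) + T M₀ z₀ c₀ (e b)) :=
  le_min (h.bond ha hb) (chartByG_bond h.1 ha hb)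

/-- ★ SITE ⟹ PAIR: a graded chart is a GB-chart at every pair table dominating its site sums — the pair clause then carries nothing. [folklore] -/
theorem chartByGB_of_chartByG_of_sumLE (h : ChartByG 𝓘 τ T z c z₀ c₀ e) (hB : SumLE T B) : ChartByGB 𝓘 τ T B z c z₀ c₀ e := by
  refine ⟨h, fun a b ha hb => ?_⟩
  rw [dist_eq_norm, disp_diff_eq]
  exact (h.disp_diff ha hb).trans (hB M₀ z₀ c₀ (e a) (e b))

/-- ★ RECOVERY at chart level: at `B = pairSum T` the GB-chart IS the graded chart. [formal bookkeeping] -/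
theorem chartByGB_pairSum_iff : ChartByGB 𝓘 τ T (pairSum T) z c z₀ c₀ e ↔ ChartByG 𝓘 τ T z c z₀ c₀ e :=
  ⟨fun h => h.1, fun h => chartByGB_of_chartByG_of_sumLE h (PairLE.refl _)⟩

/-- The GB-chart loosens with the pair table… [formal bookkeeping] -/
theorem ChartByGB.mono_pair (h : ChartByGB 𝓘 τ T B z c z₀ c₀ e) (hle : PairLE B B') : ChartByGB 𝓘 τ T B' z c z₀ c₀ e :=
  ⟨h.1, fun a b ha hb => (h.2 a b ha hb).trans (hle M₀ z₀ c₀ (e a) (e b))⟩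

/-- … with the site table… [formal bookkeeping] -/
theorem ChartByGB.mono_tol (h : ChartByGB 𝓘 τ T B z c z₀ c₀ e) (hle : TolLE T T') : ChartByGB 𝓘 τ T' B z c z₀ c₀ e :=
  ⟨h.1.mono_tol hle, h.2⟩

/-- … with the family… [formal bookkeeping] -/
theorem ChartByGB.mono_family (h : ChartByGB 𝓘 τ T B z c z₀ c₀ e) (hle : FamilyLE 𝓘 𝓘') : ChartByGB 𝓘' τ T B z c z₀ c₀ e :=
  ⟨h.1.mono_family hle, h.2⟩

/-- … and with the scalar. [formal bookkeeping] -/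
theorem chartByGB_mono_scalar (h : ChartByGB 𝓘 τ T B z c z₀ c₀ e) (hle : τ ≤ τ') : ChartByGB 𝓘 τ' T B z c z₀ c₀ e :=
  ⟨chartByG_mono_scalar h.1 hle, h.2⟩

/-- ★ SAME-HOST WEAKENING in all four data. [formal bookkeeping] -/
theorem ChartByGB.weaken (h : ChartByGB 𝓘 τ T B z c z₀ c₀ e) (h𝓘 : FamilyLE 𝓘 𝓘') (hT : TolLE T T') (hB : PairLE B B') (hτ : τ ≤ τ') :
    ChartByGB 𝓘' τ' T' B' z c z₀ c₀ e :=
  ((chartByGB_mono_scalar (h.mono_pair hB) hτ).mono_tol hT).mono_family h𝓘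

/-- Two pair tables on the same chart meet. [formal bookkeeping] -/
theorem ChartByGB.inf_pair (h : ChartByGB 𝓘 τ T B z c z₀ c₀ e) (h' : ChartByGB 𝓘 τ T B' z c z₀ c₀ e) :
    ChartByGB 𝓘 τ T (fun M₀ z₀ c₀ a b => min (B M₀ z₀ c₀ a b) (B' M₀ z₀ c₀ a b)) z c z₀ c₀ e :=
  ⟨h.1, fun a b ha hb => le_min (h.2 a b ha hb) (h'.2 a b ha hb)⟩

/-- The centre's own displacement vanishes: `D c = 0` (the chart sends `c ↦ c₀`). [formal bookkeeping] -/
theorem ChartByGB.centre_eq (h : ChartByGB 𝓘 τ T B z c z₀ c₀ e) : e c = c₀ := h.1.1.2.1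

/-- ★ PAIR ⟹ SITE THROUGH THE CENTRE: `‖D a‖ ≤ B(e a, c₀)` — the pair table's column at the centre IS a site table. [folklore] -/
theorem ChartByGB.dev_centre (h : ChartByGB 𝓘 τ T B z c z₀ c₀ e) {a : Fin M} (ha : dist (z a) (z c) ≤ 63 / 10) :
    dist (z a - z c) (z₀ (e a) - z₀ c₀) ≤ B M₀ z₀ c₀ (e a) c₀ := by
  have hc : dist (z c) (z c) ≤ 63 / 10 := by rw [dist_self]; norm_num
  have h₁ := h.2 a c ha hc
  rwa [h.centre_eq] at h₁

/-- ★ … hence a GB-chart is a graded chart at the site table `T ⊓ B(·, c₀)`. [folklore] -/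
theorem ChartByGB.siteOfPair (h : ChartByGB 𝓘 τ T B z c z₀ c₀ e) :
    ChartByG 𝓘 τ (fun M₀ z₀ c₀ a => min (T M₀ z₀ c₀ a) (B M₀ z₀ c₀ a c₀)) z c z₀ c₀ e :=
  ⟨h.1.1, fun a ha => le_min (h.1.2 a ha) (h.dev_centre ha)⟩

/-- ★ ONE-STEP CHAIN: `‖D a‖ ≤ B(e a, e b) + T(e b)` — a site's displacement is controlled by a bond budget plus its neighbour's box (the pair currency
integrates to the site currency along host paths). [folklore] -/
theorem ChartByGB.dev_via (h : ChartByGB 𝓘 τ T B z c z₀ c₀ e) {a b : Fin M} (ha : dist (z a) (z c) ≤ 63 / 10) (hb : dist (z b) (z c) ≤ 63 / 10) :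
    dist (z a - z c) (z₀ (e a) - z₀ c₀) ≤ B M₀ z₀ c₀ (e a) (e b) + T M₀ z₀ c₀ (e b) := by
  have h₁ := h.norm_disp_diff ha hb
  have h₂ := h.1.norm_disp hb
  rw [dist_eq_norm]
  have key : (z a - z c) - (z₀ (e a) - z₀ c₀) =
      (((z a - z c) - (z₀ (e a) - z₀ c₀)) - ((z b - z c) - (z₀ (e b) - z₀ c₀))) + ((z b - z c) - (z₀ (e b) - z₀ c₀)) := by abel
  rw [key]
  exact (norm_add_le _ _).trans (add_le_add h₁ h₂)

/-- … TWO-STEP CHAIN: `‖D a‖ ≤ B(e a, e b) + B(e b, c₀)`. [folklore] -/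
theorem ChartByGB.dev_via₂ (h : ChartByGB 𝓘 τ T B z c z₀ c₀ e) {a b : Fin M} (ha : dist (z a) (z c) ≤ 63 / 10) (hb : dist (z b) (z c) ≤ 63 / 10) :
    dist (z a - z c) (z₀ (e a) - z₀ c₀) ≤ B M₀ z₀ c₀ (e a) (e b) + B M₀ z₀ c₀ (e b) c₀ := by
  have h₁ := h.norm_disp_diff ha hb
  have h₂ := h.dev_centre hb
  rw [dist_eq_norm] at h₂ ⊢
  have key : (z a - z c) - (z₀ (e a) - z₀ c₀) =
      (((z a - z c) - (z₀ (e a) - z₀ c₀)) - ((z b - z c) - (z₀ (e b) - z₀ c₀))) + ((z b - z c) - (z₀ (e b) - z₀ c₀)) := by abel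
  rw [key]
  exact (norm_add_le _ _).trans (add_le_add h₁ h₂)

/-- At the cone table two GB-charted ball sites have bond deviation `≤ β + s·(host bond length)`. [formal bookkeeping] -/
theorem ChartByGB.bond_cone {β s : ℝ} (h : ChartByGB 𝓘 τ T (conePair β s) z c z₀ c₀ e) {a b : Fin M} (ha : dist (z a) (z c) ≤ 63 / 10)
    (hb : dist (z b) (z c) ≤ 63 / 10) : |dist (z a) (z b) - dist (z₀ (e a)) (z₀ (e b))| ≤ β + s * dist (z₀ (e a)) (z₀ (e b)) :=
  h.bond ha hb

end Chart

/-! ## §2. The two leaves and their order -/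

/-- (piece) [route statement · this cell; NOT a literature fact] ★★ **(TF-GB) `TubeFloorGB 𝓘 τ T B` [CERTIFICATE · UNDECIDED · INSTRUMENTABLE «PAIR-84-E»]** — every admissible, `63/10`-clean, `63/10`-mono-phase record
cluster that is GB-charted (scalar `τ`, site table `T`, pair table `B`) by an instance of `𝓘` scores `≥ 0`.  Weaker than (TF-G) at `(τ, T)`; antitone in
`T`, `B`, `𝓘`. -/
def TubeFloorGB (𝓘 : ChartFam) (τ : ℝ) (T : SlackTab) (B : PairTab) : Prop :=
  ∀ (M : ℕ) (z : Fin M → E3) (c : Fin M) (M₀ : ℕ) (z₀ : Fin M₀ → E3) (c₀ : Fin M₀) (e : Fin M → Fin M₀),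
    Admissible M z c → CleanBall (63 / 10) z c → MonoPhaseBall (63 / 10) z c → ChartByGB 𝓘 τ T B z c z₀ c₀ e →
      0 ≤ ballAvg (9 / 5) z (xRec M z) c

/-- (piece) [route statement · this cell; NOT a literature fact] ★★ **(BC-GB) `FamilyCoverGB 𝓘 ρ ε η₂ τ T B` [GEOMETRIC · UNDECIDED · INSTRUMENTABLE «PAIR-84-T»]** — every far-class (`¬NearHomIsoAt ρ ε`) record
cluster with an `η₂`-good centre is, modulo a linear isometry, GB-charted by an instance of the family.  Stronger than (BC-G) at `(τ, T)`; monotone in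
`T`, `B`, `𝓘`. -/
def FamilyCoverGB (𝓘 : ChartFam) (ρ ε η₂ τ : ℝ) (T : SlackTab) (B : PairTab) : Prop :=
  ∀ (M : ℕ) (z : Fin M → E3) (c : Fin M), Admissible M z c → CleanBall (63 / 10) z c → MonoPhaseBall (63 / 10) z c → ¬NearHomIsoAt ρ ε z c →
    GoodAtScale η₂ (3 / 2) z c →
      ∃ (R : E3 ≃ₗᵢ[ℝ] E3) (M₀ : ℕ) (z₀ : Fin M₀ → E3) (c₀ : Fin M₀) (e : Fin M → Fin M₀), ChartByGB 𝓘 τ T B (⇑R ∘ z) c z₀ c₀ e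

section Leaves

variable {𝓘 𝓘' : ChartFam} {ρ ε η₂ τ τ' : ℝ} {T T' : SlackTab} {B B' : PairTab}

/-- ★ (TF-GB) is ANTITONE in the pair table. [formal bookkeeping] -/
theorem TubeFloorGB.anti_pair (h : TubeFloorGB 𝓘 τ T B') (hle : PairLE B B') : TubeFloorGB 𝓘 τ T B :=
  fun M z c M₀ z₀ c₀ e hz hcl hm hch => h M z c M₀ z₀ c₀ e hz hcl hm (hch.mono_pair hle)

/-- … in the site table… [formal bookkeeping] -/
theorem TubeFloorGB.anti_tol (h : TubeFloorGB 𝓘 τ T' B) (hle : TolLE T T') : TubeFloorGB 𝓘 τ T B :=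
  fun M z c M₀ z₀ c₀ e hz hcl hm hch => h M z c M₀ z₀ c₀ e hz hcl hm (hch.mono_tol hle)

/-- … in the family… [formal bookkeeping] -/
theorem TubeFloorGB.anti_family (h : TubeFloorGB 𝓘' τ T B) (hle : FamilyLE 𝓘 𝓘') : TubeFloorGB 𝓘 τ T B :=
  fun M z c M₀ z₀ c₀ e hz hcl hm hch => h M z c M₀ z₀ c₀ e hz hcl hm (hch.mono_family hle)

/-- … and in the scalar. [formal bookkeeping] -/
theorem TubeFloorGB.anti_scalar (h : TubeFloorGB 𝓘 τ' T B) (hle : τ ≤ τ') : TubeFloorGB 𝓘 τ T B :=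
  fun M z c M₀ z₀ c₀ e hz hcl hm hch => h M z c M₀ z₀ c₀ e hz hcl hm (chartByGB_mono_scalar hch hle)

/-- ★ (TF-G) ⟹ (TF-GB) at every pair table: the pair leaf is WEAKER than the graded certificate at the same site data. [formal bookkeeping] -/
theorem tubeFloorGB_of_tubeFloorG (h : TubeFloorG 𝓘 τ T) (B : PairTab) : TubeFloorGB 𝓘 τ T B :=
  fun M z c M₀ z₀ c₀ e hz hcl hm hch => h M z c M₀ z₀ c₀ e hz hcl hm hch.1

/-- ★ … and conversely at a pair table dominating the site sums. [formal bookkeeping] -/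
theorem tubeFloorG_of_tubeFloorGB_of_sumLE (h : TubeFloorGB 𝓘 τ T B) (hB : SumLE T B) : TubeFloorG 𝓘 τ T :=
  fun M z c M₀ z₀ c₀ e hz hcl hm hch => h M z c M₀ z₀ c₀ e hz hcl hm (chartByGB_of_chartByG_of_sumLE hch hB)

/-- ★★ RECOVERY: at `B = pairSum T` the pair leaf IS (TF-G). [formal bookkeeping] -/
theorem tubeFloorGB_pairSum_iff : TubeFloorGB 𝓘 τ T (pairSum T) ↔ TubeFloorG 𝓘 τ T :=
  ⟨fun h => tubeFloorG_of_tubeFloorGB_of_sumLE h (PairLE.refl _), fun h => tubeFloorGB_of_tubeFloorG h _⟩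

/-- ★★ THE SANDWICH (certificate side): a pair certificate at `(τ, T, B)` certifies EVERY site table `T′ ≤ T` whose sums fit under `B` — so
`(TF-G)(τ, T) ⟹ (TF-GB)(τ, T, B) ⟹ (TF-G)(τ, T′)`: the pair cell lies between the loose and the tight uniform cells. [folklore] -/
theorem tubeFloorG_of_tubeFloorGB_of_le_of_sumLE (h : TubeFloorGB 𝓘 τ T B) (hT : TolLE T' T) (hB : SumLE T' B) : TubeFloorG 𝓘 τ T' :=
  fun M z c M₀ z₀ c₀ e hz hcl hm hch => h M z c M₀ z₀ c₀ e hz hcl hm ((chartByGB_of_chartByG_of_sumLE hch hB).mono_tol hT)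

/-- … numerically: the pure pair cell at scalar `τ₀` and constant pair budget `β ≤ 2τ₀` certifies the UNIFORM cell at `β/2`. [formal bookkeeping] -/
theorem tubeFloor_half_of_tubeFloorGB_const {τ₀ β : ℝ} (hβ : β / 2 ≤ τ₀) (h : TubeFloorGB 𝓘 τ₀ (constTol τ₀) (constPair β)) :
    TubeFloorG 𝓘 τ₀ (constTol (β / 2)) :=
  tubeFloorG_of_tubeFloorGB_of_le_of_sumLE h (tolLE_constTol hβ) (sumLE_constPair_of_le (TolLE.refl _))

/-- ★ (BC-GB) is MONOTONE in the pair table. [formal bookkeeping] -/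
theorem FamilyCoverGB.mono_pair (h : FamilyCoverGB 𝓘 ρ ε η₂ τ T B) (hle : PairLE B B') : FamilyCoverGB 𝓘 ρ ε η₂ τ T B' := by
  intro M z c hz hcl hm hn hg
  obtain ⟨R, M₀, z₀, c₀, e, hch⟩ := h M z c hz hcl hm hn hg
  exact ⟨R, M₀, z₀, c₀, e, hch.mono_pair hle⟩

/-- … in the site table… [formal bookkeeping] -/
theorem FamilyCoverGB.mono_tol (h : FamilyCoverGB 𝓘 ρ ε η₂ τ T B) (hle : TolLE T T') : FamilyCoverGB 𝓘 ρ ε η₂ τ T' B := by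
  intro M z c hz hcl hm hn hg
  obtain ⟨R, M₀, z₀, c₀, e, hch⟩ := h M z c hz hcl hm hn hg
  exact ⟨R, M₀, z₀, c₀, e, hch.mono_tol hle⟩

/-- … in the family… [formal bookkeeping] -/
theorem FamilyCoverGB.mono_family (h : FamilyCoverGB 𝓘 ρ ε η₂ τ T B) (hle : FamilyLE 𝓘 𝓘') : FamilyCoverGB 𝓘' ρ ε η₂ τ T B := by
  intro M z c hz hcl hm hn hg
  obtain ⟨R, M₀, z₀, c₀, e, hch⟩ := h M z c hz hcl hm hn hg
  exact ⟨R, M₀, z₀, c₀, e, hch.mono_family hle⟩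

/-- … and in the scalar. [formal bookkeeping] -/
theorem FamilyCoverGB.mono_scalar (h : FamilyCoverGB 𝓘 ρ ε η₂ τ T B) (hle : τ ≤ τ') : FamilyCoverGB 𝓘 ρ ε η₂ τ' T B := by
  intro M z c hz hcl hm hn hg
  obtain ⟨R, M₀, z₀, c₀, e, hch⟩ := h M z c hz hcl hm hn hg
  exact ⟨R, M₀, z₀, c₀, e, chartByGB_mono_scalar hch hle⟩

/-- ★ (BC-GB) ⟹ (BC-G): the pair cover is STRONGER than the graded cover at the same site data. [formal bookkeeping] -/
theorem familyCoverG_of_familyCoverGB (h : FamilyCoverGB 𝓘 ρ ε η₂ τ T B) : FamilyCoverG 𝓘 ρ ε η₂ τ T := by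
  intro M z c hz hcl hm hn hg
  obtain ⟨R, M₀, z₀, c₀, e, hch⟩ := h M z c hz hcl hm hn hg
  exact ⟨R, M₀, z₀, c₀, e, hch.1⟩

/-- ★ … and conversely at a pair table dominating the site sums. [formal bookkeeping] -/
theorem familyCoverGB_of_familyCoverG_of_sumLE (h : FamilyCoverG 𝓘 ρ ε η₂ τ T) (hB : SumLE T B) : FamilyCoverGB 𝓘 ρ ε η₂ τ T B := by
  intro M z c hz hcl hm hn hg
  obtain ⟨R, M₀, z₀, c₀, e, hch⟩ := h M z c hz hcl hm hn hg
  exact ⟨R, M₀, z₀, c₀, e, chartByGB_of_chartByG_of_sumLE hch hB⟩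

/-- ★★ RECOVERY: at `B = pairSum T` the pair cover IS (BC-G). [formal bookkeeping] -/
theorem familyCoverGB_pairSum_iff : FamilyCoverGB 𝓘 ρ ε η₂ τ T (pairSum T) ↔ FamilyCoverG 𝓘 ρ ε η₂ τ T :=
  ⟨familyCoverG_of_familyCoverGB, fun h => familyCoverGB_of_familyCoverG_of_sumLE h (PairLE.refl _)⟩

/-- ★★ THE SANDWICH (cover side): a graded cover at a TIGHT site table `T′ ≤ T` whose sums fit under `B` gives the pair cover at `(τ, T, B)` — so
`(BC-G)(τ, T′) ⟹ (BC-GB)(τ, T, B) ⟹ (BC-G)(τ, T)`. [folklore] -/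
theorem familyCoverGB_of_familyCoverG_of_le_of_sumLE (h : FamilyCoverG 𝓘 ρ ε η₂ τ T') (hT : TolLE T' T) (hB : SumLE T' B) :
    FamilyCoverGB 𝓘 ρ ε η₂ τ T B :=
  (familyCoverGB_of_familyCoverG_of_sumLE h hB).mono_tol hT

/-- ★ The pair cover delivers the graded cover at the DERIVED site table `T ⊓ B(·, c₀)` (pair ⟹ site through the centre). [folklore] -/
theorem familyCoverG_siteOfPair_of_familyCoverGB (h : FamilyCoverGB 𝓘 ρ ε η₂ τ T B) :
    FamilyCoverG 𝓘 ρ ε η₂ τ (fun M₀ z₀ c₀ a => min (T M₀ z₀ c₀ a) (B M₀ z₀ c₀ a c₀)) := by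
  intro M z c hz hcl hm hn hg
  obtain ⟨R, M₀, z₀, c₀, e, hch⟩ := h M z c hz hcl hm hn hg
  exact ⟨R, M₀, z₀, c₀, e, hch.siteOfPair⟩

end Leaves

end Summit.AtomisticToContinuum.Crystallization.Theorems.FrustratedLawDichotomyStrainedPatchPairTube
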